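import Mathlib
import Summits.Ventures.HodgeRepro.Tier4.Common.AdelicDefs
import Summits.Ventures.HodgeRepro.Tier4.Line1.PlaneDefs

/-!
# Tier4/Line1/WittQuasiReflection — hermitian quasi-reflections of a plane `(B, Ω)` over any field (local Witt, part 1)

Blind re-derivation cell `pub-hodge-repro`, Tier 4 «PROVE THE STEP» (README §9–§10), LINE L1, seat t4-L1-p3 (prover);
the algebra behind LOCAL WITT (`hwitt` of t4-L1-p2's C7LocalWitt p673752; my claim S13080). Over ANY field `F`
(characteristic `0` where `2 ≠ 0` is needed), for `B` symmetric, `Ω` with `Ω² = −d` (`d ≠ 0`) and `Ω B = −B Ωᵀ` (row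
convention, `β(z, z′) := z ᵥ* B ⬝ᵥ z′`), `A := F[Ω]` acts on rows by `z ↦ η₀ z + η₁ zΩ` (`scal`). For `u` with
`c := β(u, u) ≠ 0` the `A`-linear `β`-orthogonal projection onto the `A`-line of `u` is
`projA u : z ↦ (β(z,u)/c) u + (β(z,uΩ)/(d c)) uΩ`, and for `ε = ε₀ + ε₁ Ω ∈ A` of norm one the quasi-reflection
`qrefl u ε := 1 − projA u · (1 − ε)` acts by `ε` on the line and by `1` on its orthogonal: it commutes with `Ω`
(`qrefl_mul_Ω`) and preserves `β` (`pairR_qrefl`, a polynomial identity modulo `ε₀² + d ε₁² = 1`). For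
`β(x,x) = β(y,y)`, `u := x − y` with `c ≠ 0` and `h(u, x) ∈ A` invertible (`d c² + 4 β(x, uΩ)² ≠ 0`) the choice
`ε := 1 − p(x)⁻¹`, `p(x) = h(u,x)/h(u,u) = (1/2, β(x,uΩ)/(d c))`, gives `x · qrefl = y` (`exists_qrefl_vecMul_eq`).
Nothing here assumes anisotropy or that `−d` is a non-square: `A` may be `F × F`. Mathlib only; no printed input.

Nothing here says anything about the status of the Hodge conjecture for CM abelian varieties, which is NOT proved
(HC_CM is NOT proved by anyone in this repository).
-/

set_option autoImplicit false

noncomputable section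

namespace Summit.Ventures.HodgeRepro.Tier4.Line1.Witt

open Matrix

variable {F : Type*} [Field F] {B Ω : Matrix (Fin 4) (Fin 4) F} {d : F}

/-! ## 1. The row-convention identities of a hermitian plane `(B, Ω)`: `β(z, z') := z ᵥ* B ⬝ᵥ z'` -/

/-- `β` is symmetric. -/
theorem pairR_comm (hB : Bᵀ = B) (z z' : Fin 4 → F) : z ᵥ* B ⬝ᵥ z' = z' ᵥ* B ⬝ᵥ z := by
  calc z ᵥ* B ⬝ᵥ z' = z ⬝ᵥ (B *ᵥ z') := (Matrix.dotProduct_mulVec z B z').symm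
    _ = z ⬝ᵥ (Bᵀ *ᵥ z') := by rw [hB]
    _ = z ⬝ᵥ (z' ᵥ* B) := by rw [Matrix.mulVec_transpose]
    _ = z' ᵥ* B ⬝ᵥ z := dotProduct_comm _ _

/-- `Ω` is skew-adjoint for `β`: `β(zΩ, z') = −β(z, z'Ω)`. -/
theorem pairR_Ω_left (hrow : Ω * B = -(B * Ωᵀ)) (z z' : Fin 4 → F) :
    (z ᵥ* Ω) ᵥ* B ⬝ᵥ z' = -(z ᵥ* B ⬝ᵥ (z' ᵥ* Ω)) := by
  rw [Matrix.vecMul_vecMul, hrow, Matrix.vecMul_neg, neg_dotProduct, ← Matrix.vecMul_vecMul,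
    ← Matrix.dotProduct_mulVec, Matrix.mulVec_transpose]

/-- `Ω² = −d`. -/
theorem vecMul_Ω_Ω (hΩ : Ω * Ω = -(d • (1 : Matrix (Fin 4) (Fin 4) F))) (z : Fin 4 → F) :
    (z ᵥ* Ω) ᵥ* Ω = -(d • z) := by
  rw [Matrix.vecMul_vecMul, hΩ, Matrix.vecMul_neg, Matrix.vecMul_smul, Matrix.vecMul_one]

/-- `β(zΩ, z) = 0` (characteristic `≠ 2`). -/
theorem pairR_Ω_self [CharZero F] (hB : Bᵀ = B) (hrow : Ω * B = -(B * Ωᵀ)) (z : Fin 4 → F) :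
    (z ᵥ* Ω) ᵥ* B ⬝ᵥ z = 0 := by
  have h := pairR_Ω_left hrow z z
  rw [pairR_comm hB z (z ᵥ* Ω)] at h
  have h2 : (2 : F) * ((z ᵥ* Ω) ᵥ* B ⬝ᵥ z) = 0 := by linear_combination h
  exact (mul_eq_zero.mp h2).resolve_left two_ne_zero

/-- `β(zΩ, z'Ω) = d β(z, z')`. -/
theorem pairR_Ω_Ω (hrow : Ω * B = -(B * Ωᵀ)) (hΩ : Ω * Ω = -(d • (1 : Matrix (Fin 4) (Fin 4) F)))
    (z z' : Fin 4 → F) : (z ᵥ* Ω) ᵥ* B ⬝ᵥ (z' ᵥ* Ω) = d * (z ᵥ* B ⬝ᵥ z') := by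
  rw [pairR_Ω_left hrow, vecMul_Ω_Ω hΩ, dotProduct_neg, dotProduct_smul, neg_neg, smul_eq_mul]

/-- Two matrices with the same row action are equal. -/
theorem ext_of_vecMul {M N : Matrix (Fin 4) (Fin 4) F} (h : ∀ z : Fin 4 → F, z ᵥ* M = z ᵥ* N) : M = N := by
  ext i j
  have := congrFun (h (Pi.single i 1)) j
  rwa [Matrix.single_one_vecMul, Matrix.single_one_vecMul] at this

/-- `(M * B * Mᵀ) i j = β(e_i M, e_j M)`. -/
theorem mul_B_mul_transpose_apply (M : Matrix (Fin 4) (Fin 4) F) (i j : Fin 4) :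
    (M * B * Mᵀ) i j = (Pi.single i 1 ᵥ* M) ᵥ* B ⬝ᵥ (Pi.single j 1 ᵥ* M) := by
  rw [Matrix.single_one_vecMul, Matrix.single_one_vecMul]
  simp only [Matrix.mul_apply, Matrix.transpose_apply, Matrix.vecMul, dotProduct, Matrix.row]

/-- A matrix whose row action preserves `β` is a `β`-isometry: `M * B * Mᵀ = B`. -/
theorem isometry_of_pairR {M : Matrix (Fin 4) (Fin 4) F}
    (h : ∀ z z' : Fin 4 → F, (z ᵥ* M) ᵥ* B ⬝ᵥ (z' ᵥ* M) = z ᵥ* B ⬝ᵥ z') : M * B * Mᵀ = B := by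
  ext i j
  rw [mul_B_mul_transpose_apply, h, Matrix.single_one_vecMul, dotProduct_single, mul_one]
  rfl

/-! ## 2. The `A`-linear projection onto the `A`-line of `u` and the quasi-reflections -/

/-- The `A = F[Ω]`-linear `β`-orthogonal projection onto the `A`-line `span(u, uΩ)` (row convention):
`z ↦ (β(z,u)/β(u,u)) u + (β(z,uΩ)/(d β(u,u))) uΩ`. -/
def projA (B Ω : Matrix (Fin 4) (Fin 4) F) (d : F) (u : Fin 4 → F) : Matrix (Fin 4) (Fin 4) F :=
  (u ᵥ* B ⬝ᵥ u)⁻¹ • (vecMulVec (B *ᵥ u) u + d⁻¹ • vecMulVec (B *ᵥ (u ᵥ* Ω)) (u ᵥ* Ω))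

/-- The row action of `projA`. -/
theorem vecMul_projA (u z : Fin 4 → F) :
    z ᵥ* projA B Ω d u =
      (u ᵥ* B ⬝ᵥ u)⁻¹ • ((z ᵥ* B ⬝ᵥ u) • u + d⁻¹ • ((z ᵥ* B ⬝ᵥ (u ᵥ* Ω)) • (u ᵥ* Ω))) := by
  simp only [projA, Matrix.vecMul_smul, Matrix.vecMul_add, Matrix.vecMul_vecMulVec, Matrix.dotProduct_mulVec]

/-- The quasi-reflection `σ_{u,ε} = 1 − P_u (1 − ε)`, `ε = ε₀ + ε₁ Ω ∈ A`: acts by `ε` on the `A`-line of `u` and by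
`1` on its `β`-orthogonal complement. -/
def qrefl (B Ω : Matrix (Fin 4) (Fin 4) F) (d : F) (u : Fin 4 → F) (ε₀ ε₁ : F) : Matrix (Fin 4) (Fin 4) F :=
  1 - projA B Ω d u * ((1 - ε₀) • (1 : Matrix (Fin 4) (Fin 4) F) - ε₁ • Ω)

/-- The row action of the quasi-reflection, in the coordinates `a₀ = β(z,u)/c`, `a₁ = β(z,uΩ)/(d c)`,
`c = β(u,u)`: `z σ = z − ((1−ε₀) a₀ + d ε₁ a₁) u − ((1−ε₀) a₁ − ε₁ a₀) uΩ`. -/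
theorem vecMul_qrefl (hΩ : Ω * Ω = -(d • (1 : Matrix (Fin 4) (Fin 4) F))) (hd : d ≠ 0) {u : Fin 4 → F}
    (hc : u ᵥ* B ⬝ᵥ u ≠ 0) (ε₀ ε₁ : F) {z : Fin 4 → F} {a₀ a₁ : F}
    (ha₀ : z ᵥ* B ⬝ᵥ u = (u ᵥ* B ⬝ᵥ u) * a₀) (ha₁ : z ᵥ* B ⬝ᵥ (u ᵥ* Ω) = d * (u ᵥ* B ⬝ᵥ u) * a₁) :
    z ᵥ* qrefl B Ω d u ε₀ ε₁ =
      z - ((1 - ε₀) * a₀ + d * ε₁ * a₁) • u - ((1 - ε₀) * a₁ - ε₁ * a₀) • (u ᵥ* Ω) := by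
  have hP : z ᵥ* projA B Ω d u = a₀ • u + a₁ • (u ᵥ* Ω) := by
    rw [vecMul_projA, ha₀, ha₁]
    ext i
    simp only [Pi.smul_apply, Pi.add_apply, smul_eq_mul]
    field_simp
  rw [qrefl, Matrix.vecMul_sub, Matrix.vecMul_one, ← Matrix.vecMul_vecMul, hP, Matrix.vecMul_sub,
    Matrix.vecMul_smul, Matrix.vecMul_smul, Matrix.vecMul_one, Matrix.add_vecMul, Matrix.smul_vecMul,
    Matrix.smul_vecMul, vecMul_Ω_Ω hΩ]
  ext i
  simp only [Pi.sub_apply, Pi.add_apply, Pi.smul_apply, Pi.neg_apply, smul_eq_mul]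
  ring

/-- `projA` commutes with `Ω` (it is `A`-linear). -/
theorem projA_mul_Ω (hrow : Ω * B = -(B * Ωᵀ))
    (hΩ : Ω * Ω = -(d • (1 : Matrix (Fin 4) (Fin 4) F))) (hd : d ≠ 0) (u : Fin 4 → F) :
    projA B Ω d u * Ω = Ω * projA B Ω d u := by
  refine ext_of_vecMul fun z => ?_
  rw [← Matrix.vecMul_vecMul, ← Matrix.vecMul_vecMul, vecMul_projA, vecMul_projA, pairR_Ω_left hrow,
    pairR_Ω_Ω hrow hΩ]
  simp only [Matrix.smul_vecMul, Matrix.add_vecMul, vecMul_Ω_Ω hΩ]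
  ext i
  simp only [Pi.smul_apply, Pi.add_apply, Pi.neg_apply, smul_eq_mul]
  field_simp
  ring

/-- The quasi-reflection commutes with `Ω`. -/
theorem qrefl_mul_Ω (hrow : Ω * B = -(B * Ωᵀ))
    (hΩ : Ω * Ω = -(d • (1 : Matrix (Fin 4) (Fin 4) F))) (hd : d ≠ 0) (u : Fin 4 → F) (ε₀ ε₁ : F) :
    qrefl B Ω d u ε₀ ε₁ * Ω = Ω * qrefl B Ω d u ε₀ ε₁ := by
  obtain ⟨E, hEdef⟩ : ∃ E : Matrix (Fin 4) (Fin 4) F, E = (1 - ε₀) • (1 : Matrix (Fin 4) (Fin 4) F) - ε₁ • Ω :=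
    ⟨_, rfl⟩
  have hE : E * Ω = Ω * E := by
    rw [hEdef]
    simp only [Matrix.sub_mul, Matrix.mul_sub, Matrix.smul_mul, Matrix.mul_smul, Matrix.one_mul, Matrix.mul_one]
  have key : projA B Ω d u * E * Ω = Ω * (projA B Ω d u * E) := by
    rw [Matrix.mul_assoc, hE, ← Matrix.mul_assoc, projA_mul_Ω hrow hΩ hd, Matrix.mul_assoc]
  rw [qrefl, ← hEdef, Matrix.sub_mul, Matrix.mul_sub, Matrix.one_mul, Matrix.mul_one, key]

/-- **The quasi-reflection is a `β`-isometry** for `ε` of norm one (`ε₀² + d ε₁² = 1`), pointwise. -/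
theorem pairR_qrefl [CharZero F] (hB : Bᵀ = B) (hrow : Ω * B = -(B * Ωᵀ))
    (hΩ : Ω * Ω = -(d • (1 : Matrix (Fin 4) (Fin 4) F))) (hd : d ≠ 0) {u : Fin 4 → F}
    (hc : u ᵥ* B ⬝ᵥ u ≠ 0) {ε₀ ε₁ : F} (hε : ε₀ * ε₀ + d * (ε₁ * ε₁) = 1) (z z' : Fin 4 → F) :
    (z ᵥ* qrefl B Ω d u ε₀ ε₁) ᵥ* B ⬝ᵥ (z' ᵥ* qrefl B Ω d u ε₀ ε₁) = z ᵥ* B ⬝ᵥ z' := by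
  obtain ⟨a₀, ha₀⟩ : ∃ a₀, z ᵥ* B ⬝ᵥ u = (u ᵥ* B ⬝ᵥ u) * a₀ := ⟨(z ᵥ* B ⬝ᵥ u) / (u ᵥ* B ⬝ᵥ u), by field_simp⟩
  obtain ⟨a₁, ha₁⟩ : ∃ a₁, z ᵥ* B ⬝ᵥ (u ᵥ* Ω) = d * (u ᵥ* B ⬝ᵥ u) * a₁ :=
    ⟨(z ᵥ* B ⬝ᵥ (u ᵥ* Ω)) / (d * (u ᵥ* B ⬝ᵥ u)), by field_simp⟩
  obtain ⟨b₀, hb₀⟩ : ∃ b₀, z' ᵥ* B ⬝ᵥ u = (u ᵥ* B ⬝ᵥ u) * b₀ :=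
    ⟨(z' ᵥ* B ⬝ᵥ u) / (u ᵥ* B ⬝ᵥ u), by field_simp⟩
  obtain ⟨b₁, hb₁⟩ : ∃ b₁, z' ᵥ* B ⬝ᵥ (u ᵥ* Ω) = d * (u ᵥ* B ⬝ᵥ u) * b₁ :=
    ⟨(z' ᵥ* B ⬝ᵥ (u ᵥ* Ω)) / (d * (u ᵥ* B ⬝ᵥ u)), by field_simp⟩
  rw [vecMul_qrefl hΩ hd hc ε₀ ε₁ ha₀ ha₁, vecMul_qrefl hΩ hd hc ε₀ ε₁ hb₀ hb₁]
  have e1 : u ᵥ* B ⬝ᵥ z' = (u ᵥ* B ⬝ᵥ u) * b₀ := by rw [pairR_comm hB]; exact hb₀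
  have e2 : (u ᵥ* Ω) ᵥ* B ⬝ᵥ z' = d * (u ᵥ* B ⬝ᵥ u) * b₁ := by rw [pairR_comm hB]; exact hb₁
  have e3 : u ᵥ* B ⬝ᵥ (u ᵥ* Ω) = 0 := by rw [pairR_comm hB]; exact pairR_Ω_self hB hrow u
  have e4 : (u ᵥ* Ω) ᵥ* B ⬝ᵥ u = 0 := pairR_Ω_self hB hrow u
  have e5 : (u ᵥ* Ω) ᵥ* B ⬝ᵥ (u ᵥ* Ω) = d * (u ᵥ* B ⬝ᵥ u) := pairR_Ω_Ω hrow hΩ u u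
  simp only [Matrix.sub_vecMul, Matrix.smul_vecMul, sub_dotProduct, dotProduct_sub, smul_dotProduct,
    dotProduct_smul, smul_eq_mul, ha₀, ha₁, e1, e2, e3, e4, e5]
  linear_combination ((u ᵥ* B ⬝ᵥ u) * (a₀ * b₀ + d * (a₁ * b₁))) * hε

/-! ## 3. The norm-one scalars of `A` act by isometries -/

/-- The row action of the scalar `η = η₀ + η₁ Ω ∈ A`: `z ↦ η₀ z + η₁ zΩ`. -/
def scal (Ω : Matrix (Fin 4) (Fin 4) F) (η₀ η₁ : F) : Matrix (Fin 4) (Fin 4) F := η₀ • 1 + η₁ • Ω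

/-- The row action of `scal`. -/
theorem vecMul_scal (η₀ η₁ : F) (z : Fin 4 → F) : z ᵥ* scal Ω η₀ η₁ = η₀ • z + η₁ • (z ᵥ* Ω) := by
  simp only [scal, Matrix.vecMul_add, Matrix.vecMul_smul, Matrix.vecMul_one]

/-- `scal` commutes with `Ω`. -/
theorem scal_mul_Ω (η₀ η₁ : F) : scal Ω η₀ η₁ * Ω = Ω * scal Ω η₀ η₁ := by
  simp only [scal, Matrix.add_mul, Matrix.mul_add, Matrix.smul_mul, Matrix.mul_smul, Matrix.one_mul, Matrix.mul_one]

/-- `β(zη, z'η) = N(η) β(z, z')`. -/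
theorem pairR_scal (hB : Bᵀ = B) (hrow : Ω * B = -(B * Ωᵀ))
    (hΩ : Ω * Ω = -(d • (1 : Matrix (Fin 4) (Fin 4) F))) (η₀ η₁ : F) (z z' : Fin 4 → F) :
    (z ᵥ* scal Ω η₀ η₁) ᵥ* B ⬝ᵥ (z' ᵥ* scal Ω η₀ η₁) = (η₀ * η₀ + d * (η₁ * η₁)) * (z ᵥ* B ⬝ᵥ z') := by
  rw [vecMul_scal, vecMul_scal]
  have e1 : (z ᵥ* Ω) ᵥ* B ⬝ᵥ z' = -(z ᵥ* B ⬝ᵥ (z' ᵥ* Ω)) := pairR_Ω_left hrow z z'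
  have e2 : (z ᵥ* Ω) ᵥ* B ⬝ᵥ (z' ᵥ* Ω) = d * (z ᵥ* B ⬝ᵥ z') := pairR_Ω_Ω hrow hΩ z z'
  simp only [Matrix.add_vecMul, Matrix.smul_vecMul, add_dotProduct, dotProduct_add, smul_dotProduct,
    dotProduct_smul, smul_eq_mul, e1, e2]
  have _hB := hB
  ring

/-- The conjugate scalar inverts: `z η η̄ = N(η) z`. -/
theorem vecMul_scal_scal_conj (hΩ : Ω * Ω = -(d • (1 : Matrix (Fin 4) (Fin 4) F))) (η₀ η₁ : F)
    (z : Fin 4 → F) : (z ᵥ* scal Ω η₀ η₁) ᵥ* scal Ω η₀ (-η₁) = (η₀ * η₀ + d * (η₁ * η₁)) • z := by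
  rw [vecMul_scal, vecMul_scal, Matrix.add_vecMul, Matrix.smul_vecMul, Matrix.smul_vecMul, vecMul_Ω_Ω hΩ]
  ext i
  simp only [Pi.add_apply, Pi.smul_apply, Pi.neg_apply, smul_eq_mul]
  ring

/-! ## 4. Witt in the non-degenerate position -/

/-- **The quasi-reflection sending `x` to `y`** when `c := β(x−y, x−y) ≠ 0` and `d c² + 4 β(x, (x−y)Ω)² ≠ 0`
(the second condition says that `h(x−y, x)` is invertible in `A`; it is automatic when `A` is a field). -/
theorem exists_qrefl_vecMul_eq [CharZero F] (hB : Bᵀ = B)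
    (hΩ : Ω * Ω = -(d • (1 : Matrix (Fin 4) (Fin 4) F))) (hd : d ≠ 0) {x y : Fin 4 → F}
    (hxy : x ᵥ* B ⬝ᵥ x = y ᵥ* B ⬝ᵥ y) (hc : (x - y) ᵥ* B ⬝ᵥ (x - y) ≠ 0)
    (hN : d * ((x - y) ᵥ* B ⬝ᵥ (x - y)) * ((x - y) ᵥ* B ⬝ᵥ (x - y)) +
      4 * ((x ᵥ* B ⬝ᵥ ((x - y) ᵥ* Ω)) * (x ᵥ* B ⬝ᵥ ((x - y) ᵥ* Ω))) ≠ 0) :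
    ∃ ε₀ ε₁ : F, ε₀ * ε₀ + d * (ε₁ * ε₁) = 1 ∧ x ᵥ* qrefl B Ω d (x - y) ε₀ ε₁ = y := by
  set u := x - y with hu
  set c := u ᵥ* B ⬝ᵥ u with hcdef
  set α₁ := x ᵥ* B ⬝ᵥ (u ᵥ* Ω) with hα₁
  -- `β(x, u) = c / 2`
  have hxu : x ᵥ* B ⬝ᵥ u = c * (1 / 2) := by
    have h1 : c = x ᵥ* B ⬝ᵥ x - 2 * (x ᵥ* B ⬝ᵥ y) + y ᵥ* B ⬝ᵥ y := by
      rw [hcdef, hu, Matrix.sub_vecMul, sub_dotProduct, dotProduct_sub, dotProduct_sub, pairR_comm hB y x]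
      ring
    have h2 : x ᵥ* B ⬝ᵥ u = x ᵥ* B ⬝ᵥ x - x ᵥ* B ⬝ᵥ y := by rw [hu, dotProduct_sub]
    rw [h1, h2, ← hxy]
    ring
  set a₁ := α₁ / (d * c) with ha₁def
  have ha₁ : x ᵥ* B ⬝ᵥ (u ᵥ* Ω) = d * c * a₁ := by rw [ha₁def, hα₁]; field_simp
  set Np := 1 / 4 + d * (a₁ * a₁) with hNp
  have hNp0 : Np ≠ 0 := by
    intro h0
    apply hN
    have : α₁ = d * c * a₁ := by rw [ha₁def]; field_simp
    rw [hNp] at h0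
    rw [this]
    linear_combination (4 * d * c * c) * h0
  refine ⟨1 - (1 / 2) / Np, a₁ / Np, ?_, ?_⟩
  · field_simp
    ring
  · rw [vecMul_qrefl hΩ hd hc _ _ hxu ha₁]
    have e0 : (1 - (1 - 1 / 2 / Np)) * (1 / 2) + d * (a₁ / Np) * a₁ = 1 := by
      field_simp
      rw [hNp]
      ring
    have e1 : (1 - (1 - 1 / 2 / Np)) * a₁ - a₁ / Np * (1 / 2) = 0 := by
      field_simp
      ring
    rw [e0, e1, one_smul, zero_smul, sub_zero, hu]
    abel

end Summit.Ventures.HodgeRepro.Tier4.Line1.Witt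

end
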